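import Literature.AlgebraicGeometry.Shioda1979.Statement
import HarnessLib

/-!
# Shioda 1979: the Math. Ann. condition `(P⁴₃₉)` FAILS, although its PJA refinement holds — a semi-decomposable witness

Topic `Literature/AlgebraicGeometry/Shioda1979`. Sequel of `Shioda1979/Statement` (the Math. Ann. 245
conditions `ConditionP` = `(Pⁿₘ)` verbatim, p. 180) and of
`HodgeTheory/FermatFourfoldFiveStandardSextuples` (the same kernel recipe for `m = 25, 35`).
Everything here is PROVED (kernel computations on the printed definitions); no definition and no named
fact is introduced. Nothing here asserts or refutes the Hodge conjecture for any `Xⁿₘ`.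

## What is proved

The sextuple `ξ = {1, 7, 16, 22, 34, 37} ⊂ ℤ/39` is

* a Hodge multiset (`isHodgeMultiset_semiOnly_thirtynine`: `Σ ⟨t aᵢ⟩ = 117 = 3 · 39` for all units `t`),
  i.e. a Hodge character of the Fermat fourfold `X⁴₃₉`;
* **semi-decomposable**: `ξ = {1, 16, 22} + {7, 34, 37}`, two zero-sum triples (two characters of the
  Fermat curve `X¹₃₉`) — `isSemiDecomposable_semiOnly_thirtynine`;
* **not decomposable** (no pair `{a, -a}`; no proper non-empty sub-multiset is itself Hodge —
  `not_isDecomposable_semiOnly_thirtynine`);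
* **not quasi-decomposable** in Shioda's semigroup sense (`ξ + {e, -e} = ξ' + ξ''` with
  `ξ', ξ'' ∈ M₃₉ ∖ {ξ}` is impossible; checked over all `e ∈ ℤ/39` and all sub-multisets, the Hodge
  condition tested at the units `1, 2, 5, 7, 11, 17` — `not_isQuasiDecomposable_semiOnly_thirtynine`).

Hence **`¬ ConditionP 39 4`** (`not_conditionP_thirtynine_four`): Shioda's condition `(P⁴₃₉)` in the
Math. Ann. 245 form ("every indecomposable element of `Mₘ(3)` is quasi-decomposable", p. 180) is
FALSE, and so is `(P₃₉)` (`not_conditionPAll_thirtynine`). The witness is exactly of the kind the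
announcement [Shioda1979PJA] §1 Definition (iii) and the tree's `ShiodaConditionUpTo` admit as the third
alternative "semi-decomposable"; the Math. Ann. form (§3) does not list it, and its §4 (`M'ₘ`, `(Qₘ)`)
re-admits it. So the two printed conditions `(P⁴ₘ)` (Math. Ann.) and `(P⁴ₘ)` (PJA / `ShiodaConditionUpTo`)
are NOT equivalent at `m = 39` — a machine enumeration outside the tree (cell `pub-hfermat`, two
independent implementations) finds the PJA form TRUE at `m = 39` (all 1582 Hodge sextuple multisets
decomposable (1558), `#`-quasi-decomposable (12) or semi-decomposable-only (12, the unit orbit of `ξ`));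
that positive statement is NOT formalised here. By Shioda's Theorem III + Lemma 1 ([Shioda1979HodgeFermat]
pp. 180, 183) the eigenline of `ξ` is algebraic (Lefschetz (1,1) on `X¹₃₉ × X¹₃₉`); this file makes no
geometric claim.

## Sources
* [Shioda1979HodgeFermat] §3 (P. 180) conditions `(Pⁿₘ)`, `(Pₘ)` and the definitions decomposable /
  quasi-decomposable; §4 (p. 183) semi-decomposable, Lemma 1, `M'ₘ`.
* [Shioda1979PJA] §1 Definition (i)–(iii) (the refinement with "semi-decomposable").
-/

open Multiset

namespace Literature.AlgebraicGeometry.Shioda1979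

open Literature.AlgebraicGeometry.HodgeTheory
open Literature.AlgebraicGeometry.HodgeTheory.FermatCharacter

section ThirtyNine

/-- `ξ = {1, 7, 16, 22, 34, 37}` is a Hodge multiset mod `39` (`Σ ⟨t aᵢ⟩ = 3 · 39` for every unit `t`).
[cite: Shioda1979HodgeFermat, §1 (1.6), p. 176] -/
theorem isHodgeMultiset_semiOnly_thirtynine : IsHodgeMultiset ({1, 7, 16, 22, 34, 37} : Multiset (ZMod 39)) := by
  unfold IsHodgeMultiset mNormSum; decide +kernel

/-- `ξ` is semi-decomposable: `ξ = {1, 16, 22} + {7, 34, 37}`, two zero-sum triples.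
[cite: Shioda1979HodgeFermat, §4, p. 183 (semi-decomposable)] [cite: Shioda1979PJA, §1 Definition (iii)] -/
theorem isSemiDecomposable_semiOnly_thirtynine : IsSemiDecomposable ({1, 7, 16, 22, 34, 37} : Multiset (ZMod 39)) :=
  ⟨{1, 16, 22}, {7, 34, 37}, by decide, by decide, by decide, by decide, by decide⟩

/-- No proper non-empty sub-multiset of `ξ` is a Hodge multiset (tested at the units `1, 2, 5, 7, 11, 17`
together with the zero-sum condition): in particular `ξ` contains no pair `{a, -a}`.
[cite: Shioda1979HodgeFermat, §3, p. 180 (decomposable)] -/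
theorem sub_not_hodge_semiOnly_thirtynine :
    ∀ t ∈ Multiset.powerset ({1, 7, 16, 22, 34, 37} : Multiset (ZMod 39)), t ≠ 0 → ({1, 7, 16, 22, 34, 37} : Multiset (ZMod 39)) - t ≠ 0 →
      ¬ ((∀ a ∈ t, a ≠ 0) ∧ (t).sum = 0 ∧
            2 * mNormSum ((t).map fun a ↦ (1 : ZMod 39) * a) = 39 * Multiset.card (t) ∧
            2 * mNormSum ((t).map fun a ↦ (2 : ZMod 39) * a) = 39 * Multiset.card (t) ∧
            2 * mNormSum ((t).map fun a ↦ (5 : ZMod 39) * a) = 39 * Multiset.card (t) ∧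
            2 * mNormSum ((t).map fun a ↦ (7 : ZMod 39) * a) = 39 * Multiset.card (t) ∧
            2 * mNormSum ((t).map fun a ↦ (11 : ZMod 39) * a) = 39 * Multiset.card (t) ∧
            2 * mNormSum ((t).map fun a ↦ (17 : ZMod 39) * a) = 39 * Multiset.card (t)) := by
  decide +kernel

/-- A Hodge multiset mod `39` satisfies the finitely many conditions tested in the kernel computations
(the norm equations at the units `1, 2, 5, 7, 11, 17`). [cite: Shioda1979HodgeFermat, §1 (1.6)] -/
theorem _root_.Literature.AlgebraicGeometry.HodgeTheory.FermatCharacter.IsHodgeMultiset.conditions_thirtynine {v : Multiset (ZMod 39)} (hv : IsHodgeMultiset v) :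
    (∀ a ∈ v, a ≠ 0) ∧ v.sum = 0 ∧
      2 * mNormSum (v.map fun a ↦ (1 : ZMod 39) * a) = 39 * Multiset.card v ∧
      2 * mNormSum (v.map fun a ↦ (2 : ZMod 39) * a) = 39 * Multiset.card v ∧
      2 * mNormSum (v.map fun a ↦ (5 : ZMod 39) * a) = 39 * Multiset.card v ∧
      2 * mNormSum (v.map fun a ↦ (7 : ZMod 39) * a) = 39 * Multiset.card v ∧
      2 * mNormSum (v.map fun a ↦ (11 : ZMod 39) * a) = 39 * Multiset.card v ∧
      2 * mNormSum (v.map fun a ↦ (17 : ZMod 39) * a) = 39 * Multiset.card v := by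
  have h1 := hv.2 (Units.mkOfMulEqOne 1 1 (by decide))
  have h2 := hv.2 (Units.mkOfMulEqOne 2 20 (by decide))
  have h5 := hv.2 (Units.mkOfMulEqOne 5 8 (by decide))
  have h7 := hv.2 (Units.mkOfMulEqOne 7 28 (by decide))
  have h11 := hv.2 (Units.mkOfMulEqOne 11 32 (by decide))
  have h17 := hv.2 (Units.mkOfMulEqOne 17 23 (by decide))
  simp only [Units.val_mkOfMulEqOne] at h1 h2 h5 h7 h11 h17
  exact ⟨hv.1.1, hv.1.2, h1, h2, h5, h7, h11, h17⟩

/-- `ξ` is **not decomposable** in `M₃₉`. [cite: Shioda1979HodgeFermat, §3, p. 180 (decomposable)] -/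
theorem not_isDecomposable_semiOnly_thirtynine : ¬ IsDecomposable ({1, 7, 16, 22, 34, 37} : Multiset (ZMod 39)) := by
  rintro ⟨t, u, ht0, hu0, ht, -, heq⟩
  have htle : t ≤ ({1, 7, 16, 22, 34, 37} : Multiset (ZMod 39)) := heq ▸ Multiset.le_add_right t u
  have hu : ({1, 7, 16, 22, 34, 37} : Multiset (ZMod 39)) - t = u := by rw [heq, add_tsub_cancel_left]
  exact sub_not_hodge_semiOnly_thirtynine t (Multiset.mem_powerset.2 htle) ht0 (hu ▸ hu0)
    ht.conditions_thirtynine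

set_option maxHeartbeats 1600000 in
/-- The arithmetic heart of "`ξ` is **not quasi-decomposable** in `M₃₉`": for every `e ∈ ℤ/39` and every
splitting `ξ + {e, -e} = t + u` into non-empty parts different from `ξ`, one of `t`, `u` violates a
condition every Hodge multiset satisfies. Kernel computation, one residue `e` at a time, `39 · 2⁸` cases.
[cite: Shioda1979HodgeFermat, §3, p. 180 (quasi-decomposable)] -/
theorem semiOnly_thirtynine_key :
    ∀ e : ZMod 39, ∀ t ∈ Multiset.powerset (({1, 7, 16, 22, 34, 37} : Multiset (ZMod 39)) + {e, -e}),
      ¬ (t ≠ 0 ∧ ({1, 7, 16, 22, 34, 37} : Multiset (ZMod 39)) + {e, -e} - t ≠ 0 ∧ t ≠ ({1, 7, 16, 22, 34, 37} : Multiset (ZMod 39)) ∧ ({1, 7, 16, 22, 34, 37} : Multiset (ZMod 39)) + {e, -e} - t ≠ ({1, 7, 16, 22, 34, 37} : Multiset (ZMod 39)) ∧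
          ((∀ a ∈ t, a ≠ 0) ∧ (t).sum = 0 ∧
            2 * mNormSum ((t).map fun a ↦ (1 : ZMod 39) * a) = 39 * Multiset.card (t) ∧
            2 * mNormSum ((t).map fun a ↦ (2 : ZMod 39) * a) = 39 * Multiset.card (t) ∧
            2 * mNormSum ((t).map fun a ↦ (5 : ZMod 39) * a) = 39 * Multiset.card (t) ∧
            2 * mNormSum ((t).map fun a ↦ (7 : ZMod 39) * a) = 39 * Multiset.card (t) ∧
            2 * mNormSum ((t).map fun a ↦ (11 : ZMod 39) * a) = 39 * Multiset.card (t) ∧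
            2 * mNormSum ((t).map fun a ↦ (17 : ZMod 39) * a) = 39 * Multiset.card (t)) ∧
          ((∀ a ∈ ({1, 7, 16, 22, 34, 37} : Multiset (ZMod 39)) + {e, -e} - t, a ≠ 0) ∧ (({1, 7, 16, 22, 34, 37} : Multiset (ZMod 39)) + {e, -e} - t).sum = 0 ∧
            2 * mNormSum ((({1, 7, 16, 22, 34, 37} : Multiset (ZMod 39)) + {e, -e} - t).map fun a ↦ (1 : ZMod 39) * a) = 39 * Multiset.card (({1, 7, 16, 22, 34, 37} : Multiset (ZMod 39)) + {e, -e} - t) ∧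
            2 * mNormSum ((({1, 7, 16, 22, 34, 37} : Multiset (ZMod 39)) + {e, -e} - t).map fun a ↦ (2 : ZMod 39) * a) = 39 * Multiset.card (({1, 7, 16, 22, 34, 37} : Multiset (ZMod 39)) + {e, -e} - t) ∧
            2 * mNormSum ((({1, 7, 16, 22, 34, 37} : Multiset (ZMod 39)) + {e, -e} - t).map fun a ↦ (5 : ZMod 39) * a) = 39 * Multiset.card (({1, 7, 16, 22, 34, 37} : Multiset (ZMod 39)) + {e, -e} - t) ∧
            2 * mNormSum ((({1, 7, 16, 22, 34, 37} : Multiset (ZMod 39)) + {e, -e} - t).map fun a ↦ (7 : ZMod 39) * a) = 39 * Multiset.card (({1, 7, 16, 22, 34, 37} : Multiset (ZMod 39)) + {e, -e} - t) ∧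
            2 * mNormSum ((({1, 7, 16, 22, 34, 37} : Multiset (ZMod 39)) + {e, -e} - t).map fun a ↦ (11 : ZMod 39) * a) = 39 * Multiset.card (({1, 7, 16, 22, 34, 37} : Multiset (ZMod 39)) + {e, -e} - t) ∧
            2 * mNormSum ((({1, 7, 16, 22, 34, 37} : Multiset (ZMod 39)) + {e, -e} - t).map fun a ↦ (17 : ZMod 39) * a) = 39 * Multiset.card (({1, 7, 16, 22, 34, 37} : Multiset (ZMod 39)) + {e, -e} - t))) := by
  intro e
  obtain ⟨k, hk, rfl⟩ : ∃ k < 39, ((k : ℕ) : ZMod 39) = e :=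
    ⟨e.val, e.val_lt, ZMod.natCast_zmod_val e⟩
  interval_cases k <;> decide +kernel

/-- `ξ` is **not quasi-decomposable** (Math. Ann. 245 §3 sense: no `e ≠ 0` with `ξ + {e, -e} = ξ' + ξ''`,
`ξ', ξ'' ∈ M₃₉`, both different from `ξ`). [cite: Shioda1979HodgeFermat, §3, p. 180 (quasi-decomposable)] -/
theorem not_isQuasiDecomposable_semiOnly_thirtynine : ¬ IsQuasiDecomposable ({1, 7, 16, 22, 34, 37} : Multiset (ZMod 39)) := by
  rintro ⟨e, -, t, u, ht0, hu0, ht, hu, hts, hus, heq⟩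
  have htle : t ≤ ({1, 7, 16, 22, 34, 37} : Multiset (ZMod 39)) + {e, -e} := heq ▸ Multiset.le_add_right t u
  have hu' : ({1, 7, 16, 22, 34, 37} : Multiset (ZMod 39)) + {e, -e} - t = u := by rw [heq, add_tsub_cancel_left]
  subst hu'
  exact semiOnly_thirtynine_key e t (Multiset.mem_powerset.2 htle)
    ⟨ht0, hu0, hts, hus, ht.conditions_thirtynine, hu.conditions_thirtynine⟩

/-- **Shioda's Math. Ann. condition `(P⁴₃₉)` fails**: `ξ` is an indecomposable element of `M₃₉(3)` which is
not quasi-decomposable (it is semi-decomposable — the alternative the Math. Ann. form of `(Pⁿₘ)` does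
not admit). [cite: Shioda1979HodgeFermat, §3 condition (Pⁿₘ), p. 180] -/
theorem not_conditionP_thirtynine_four : ¬ ConditionP 39 4 := fun h ↦
  not_isQuasiDecomposable_semiOnly_thirtynine
    (h _ isHodgeMultiset_semiOnly_thirtynine (by decide) (by decide) not_isDecomposable_semiOnly_thirtynine)

/-- Hence the Math. Ann. condition `(P₃₉)` fails. [cite: Shioda1979HodgeFermat, §3 condition (Pₘ), p. 180] -/
theorem not_conditionPAll_thirtynine : ¬ ConditionPAll 39 := fun h ↦
  not_conditionP_thirtynine_four (conditionPAll_iff_forall.1 h 4)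

end ThirtyNine

end Literature.AlgebraicGeometry.Shioda1979
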